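import Literature.Barriers.CriticalPhenomena.PlaquetteWalkIsthmusRoot
import HarnessLib

/-!
# Barrier catalogue (SAWScalingLimit): DISCRETE STOKES for the plaquette vertex functional — the sum of the
Yang–Baxter vertex defects over any finite face list is a boundary sum; the contour identity on arbitrary domains

Companion of `PlaquetteWalkSpinRigidity` (the free-weight observable `gmObservable W t Dl a z` and the vertex functional
`Σ_{s ∈ (E,N,W,S)} c_s F(f₀.side s)` of a finite face list), of `YangBaxterSAWGeneralDomain` (C-B2: for an OUTER root the
printed weights satisfy the vertex relation at every face, `vertexFunctional_printed_eq_zero`) and of the lane's hole-root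
files (`PlaquetteWalkHoleRootConfinement`, `…FarCellLaw`, `…MirrorDuality`: where the relation FAILS for a HOLE root).
The printed contour arguments (Duminil-Copin–Smirnov, Lemma 2: «Sum the relation over all vertices in V(S_{T,L}). Values
at interior mid-edges disappear»; Glazman–Manolescu, before Lemma 2.2: «Summing the real part of (7) over all rhombi in a
particular domain yields a relation on the partition function» ((7) = the relation (CR) of Lemma 2.1 in v3's numbering);
the tree's `rect_contour_sum` for rectangles) are the
book-keeping identity below specialised to a strip / rectangle and combined with the vertex relation. Here the
book-keeping is separated from the relation and proved for ARBITRARY face lists, weights and coefficients: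

* §1 `sum_sub_translate_eq` — telescoping over a finite set of faces.
* §2 `boundarySum W t c Dl a` — the discrete contour integral: over the faces `f ∈ Dl` and the sides `s` with the
  neighbour `nbr f s ∉ Dl` (outer boundary AND hole boundaries, the root's own mid-edge included), `c_s · F(f.side s)`;
  ★★★ `sum_vertexFunctional_eq_boundarySum` — **DISCRETE STOKES**: for every complex weight system `W`, phase `t`,
  coefficients with `c_W = −c_E`, `c_S = −c_N` (the Glazman–Manolescu / Duminil-Copin–Smirnov shape), every finite face list
  and every root, `Σ_{f ∈ Dl} VF_{W,t,c}(Dl; a; f) = boundarySum` — the interior mid-edges cancel in pairs. No identity is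
  assumed.
* §3 ★★★ `boundarySum_printed_eq_zero_of_outerRoot` — THE CONTOUR IDENTITY ON AN ARBITRARY FINITE DOMAIN: for the printed
  weights at any `θ ∈ [π/3, 2π/3]`, on every finite face list (multiply connected ones included) and for every root on its
  OUTER boundary, the boundary sum with coefficients `(1, r(θ), −1, −r(θ))` VANISHES (GM19 Lemma 2.2 beyond rectangles);
  ★★★ `sum_vertexFunctional_printed_eq_boundarySum` — THE TOTAL-DEFECT IDENTITY for ANY root: the sum over all faces of
  the Yang–Baxter vertex defects of a hole root equals the boundary sum (outer and hole boundaries) — a global exact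
  constraint on every defect table of the venture lane; `sum_vertexFunctional_filter_eq_boundarySum` — with defect
  localisation (the defects vanish off a set `Z`, e.g. by confinement) the defects ON `Z` sum to the boundary sum.
* §4 `boundarySum_ne_root_eq_of_outerRoot`, using the tree's `gmObservable_root` (`F(a) = 1`: the empty configuration) (the contour
  identity with the root term isolated: GM19's «= 1» normalisation).
* §5 (edition 3) THE FLUX FORM: `fluxSum W t c Dl a S` — the flux of `c · F` out of an ARBITRARY finite set `S` of faces
  (`S` need not lie in `Dl`, nor be connected); ★★★ `sum_vertexFunctional_eq_fluxSum` — DISCRETE STOKES ON EVERY REGION,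
  `Σ_{f ∈ S} VF(f) = fluxSum S` (every `W`, `t`, contour-shaped `c`, `Dl`, `a`, `S`); `boundarySum_eq_fluxSum` (§ 2 = the case
  `S = Dl`); ★★ `sum_filter_vertexFunctional_eq_fluxSum` (local total-defect identity), ★★ `fluxSum_eq_zero_of_forall_eq_zero`
  (zero flux around a defect-free region), ★★ `vertexFunctional_eq_fluxSum_of_eq_zero_off` (A DEFECT IS THE FLUX THROUGH ANY
  CONTOUR AROUND IT: one exact identity per region containing it and no other defect), ★★★
  `fluxSum_printed_eq_zero_of_outerRoot` — DISCRETE HOLOMORPHICITY ON EVERY REGION for outer roots (GM19's «contour integral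
  of F around any rhombus is null», summed: C-B2 is the one-rhombus case, § 3 the whole-list case),
  `sum_vertexFunctional_printed_eq_fluxSum` (printed weights, any root, any region).

References: H. Duminil-Copin, S. Smirnov, Ann. of Math. 175 (2012), Lemma 2 and its proof («Sum the relation over all
vertices … Values at interior mid-edges disappear») [DuminilCopinSmirnov2012]; A. Glazman, I. Manolescu, arXiv:1708.00395v3,
Lemma 2.2 (p. 8) and the sentence before it (p. 7, ll. 38–39: «Summing the real part of (7) over all rhombi in a particular
domain yields a relation on the partition function analogous to that of [DCS12b][Lemma 2]»; (7) = (CR) of Lemma 2.1)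
[GlazmanManolescu2019]. Status: lane lemma / CONSOLIDATION
of the printed book-keeping at face-list generality (new only in generality: arbitrary finite face lists, holes, arbitrary
weights and coefficients); the total-defect identity for hole roots is the lane's use of it. Written for the venture lane
«pcv-sawmu» (Tier B SEARCH 1, b-engine-1 gen 17). Editions: ed.1/ed.2 = §1–§4 (ed.2: docstring quote literal); ed.3 =
ed.2 verbatim ⊕ §5 (appended); ed.4 = ed.3 minus one tree-duplicate lemma; ed.5 = ed.4 with docstring-only citation fixes
(token CS-2: the interior-cancellation wording is Duminil-Copin–Smirnov's, Glazman–Manolescu print Lemma 2.2 without proof).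
-/

noncomputable section

namespace Literature.Barriers.CriticalPhenomena.PlaquetteWalk

open Literature.Probability.RandomPlanarGeometry.SAW.YangBaxter
open Literature.Probability.RandomPlanarGeometry.SAW.YangBaxter.MidEdge
open Real Complex

/-! ## §1. Telescoping over a finite set of faces -/

/-- **Telescoping over a finite set of faces**: `Σ_{f ∈ S} (g(f + v) − g(f))` is the sum of `g(f + v)` over the faces
whose `v`-translate leaves `S` minus the sum of `g(f)` over the faces whose `(−v)`-translate is outside `S`.
[cite: GlazmanManolescu2019, §2.1, the sentence before Lemma 2.2 («Summing the real part of (7) over all rhombi in a particular domain yields a relation on the partition function»)]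
[cite: DuminilCopinSmirnov2012, proof of Lemma 2 («Values at interior mid-edges disappear»)] -/
theorem sum_sub_translate_eq (S : Finset Face) (v : Face) (g : Face → ℂ) :
    ∑ f ∈ S, (g (f + v) - g f) =
      ∑ f ∈ S.filter (fun f => f + v ∉ S), g (f + v) - ∑ f ∈ S.filter (fun f => f - v ∉ S), g f := by
  rw [Finset.sum_sub_distrib]
  -- split both sums along the interior / boundary dichotomy
  have h1 : ∑ f ∈ S, g (f + v) =
      ∑ f ∈ S.filter (fun f => f + v ∈ S), g (f + v) + ∑ f ∈ S.filter (fun f => f + v ∉ S), g (f + v) :=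
    (Finset.sum_filter_add_sum_filter_not S (fun f => f + v ∈ S) _).symm
  have h2 : ∑ f ∈ S, g f = ∑ f ∈ S.filter (fun f => f - v ∈ S), g f + ∑ f ∈ S.filter (fun f => f - v ∉ S), g f :=
    (Finset.sum_filter_add_sum_filter_not S (fun f => f - v ∈ S) _).symm
  -- the interior parts agree under `f ↦ f + v`
  have h3 : ∑ f ∈ S.filter (fun f => f + v ∈ S), g (f + v) = ∑ f ∈ S.filter (fun f => f - v ∈ S), g f := by
    refine Finset.sum_nbij' (fun f => f + v) (fun f => f - v) ?_ ?_ ?_ ?_ ?_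
    · intro f hf
      simp only [Finset.mem_filter] at hf ⊢
      exact ⟨hf.2, by rw [add_sub_cancel_right]; exact hf.1⟩
    · intro f hf
      simp only [Finset.mem_filter] at hf ⊢
      exact ⟨hf.2, by rw [sub_add_cancel]; exact hf.1⟩
    · intro f _; simp
    · intro f _; simp
    · intro f _; rfl
  rw [h1, h2, h3, add_sub_add_left_eq_sub]

/-! ## §2. The boundary sum and the discrete Stokes identity -/

/-- The slot of a side (`(E, N, W, S) ↦ (0, 1, 2, 3)`). [cite: DuminilCopinSmirnov2012, Lemma 1 (shape of the relation)] -/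
def slotOfSide : Side → Fin 4
  | .E => 0
  | .N => 1
  | .W => 2
  | .S => 3

/-- `slotSide` through `slotOfSide`. [folklore] -/
private theorem slotSide_slotOfSide (f : Face) (s : Side) : slotSide f (slotOfSide s) = f.side s := by
  cases s <;> rfl

open Classical in
/-- **The boundary sum of a face list**: over the faces `f ∈ Dl` and the sides `s` of `f` whose neighbour across `s` is
NOT in the list, `c_s · F(f.side s)` — the discrete contour integral of the observable around the face list (outer
boundary and hole boundaries alike, the root's own mid-edge included). [cite: GlazmanManolescu2019, Lemma 2.2 (stated from [Gl, Lem. 4.1]; no proof printed)] -/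
noncomputable def boundarySum (W : CWeights) (t : ℂ) (c : Fin 4 → ℂ) (Dl : List Face) (a : MidEdge) : ℂ :=
  ∑ f ∈ Dl.toFinset, ∑ s : Side, if nbr f s ∈ Dl then 0 else c (slotOfSide s) * gmObservable W t Dl a (f.side s)

/-- The vertex functional written over the four sides. [cite: DuminilCopinSmirnov2012, Lemma 1 (shape of the relation)] -/
theorem vertexFunctional_eq_four (W : CWeights) (t : ℂ) (c : Fin 4 → ℂ) (Dl : List Face) (a : MidEdge) (f : Face) :
    vertexFunctional W t c Dl a f =
      c 0 * gmObservable W t Dl a (f.side .E) + c 1 * gmObservable W t Dl a (f.side .N) +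
        c 2 * gmObservable W t Dl a (f.side .W) + c 3 * gmObservable W t Dl a (f.side .S) := by
  unfold vertexFunctional
  simp only [Fin.sum_univ_four, slotSide, Matrix.cons_val_zero, Matrix.cons_val_one, Matrix.cons_val]

/-- Sides as translates: the `E` side of `f` is the `W` side of `f + (1,0)`, the `N` side of `f` is the `S` side of
`f + (0,1)`. [cite: GlazmanManolescu2019, §1 (the lattice of rhombi and its mid-edges)] -/
theorem side_E_eq_side_W_add (f : Face) : f.side .E = (f + (1, 0)).side .W := by
  obtain ⟨k, j⟩ := f; simp [Face.side]

/-- See `side_E_eq_side_W_add`. [cite: GlazmanManolescu2019, §1 (the lattice of rhombi and its mid-edges)] -/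
theorem side_N_eq_side_S_add (f : Face) : f.side .N = (f + (0, 1)).side .S := by
  obtain ⟨k, j⟩ := f; simp [Face.side]

/-- The neighbours as translates. [cite: GlazmanManolescu2019, §1 (the lattice of rhombi and its mid-edges)] -/
theorem nbr_eq (f : Face) :
    nbr f .E = f + (1, 0) ∧ nbr f .W = f - (1, 0) ∧ nbr f .N = f + (0, 1) ∧ nbr f .S = f - (0, 1) := by
  obtain ⟨k, j⟩ := f
  simp [nbr]

open Classical in
/-- ★★★ **DISCRETE STOKES for the plaquette vertex functional.** For EVERY complex weight system `W`, phase `t`,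
coefficient vector `c` of the Glazman–Manolescu / Duminil-Copin–Smirnov shape (`c_W = −c_E`, `c_S = −c_N`), EVERY finite
face list and EVERY root: the sum of the vertex functionals over all faces of the list equals the BOUNDARY SUM — the
interior mid-edges cancel in pairs (the interior cancellation is Duminil-Copin–Smirnov's «Values at interior mid-edges
disappear», proof of Lemma 2; Glazman–Manolescu print only the sentence before Lemma 2.2). No identity is assumed; this
is the book-keeping behind every contour argument (GM19 Lemma 2.2 on rectangles, stated from [Gl, Lem. 4.1]; no proof
printed), valid on arbitrary — in particular multiply connected — face lists. [cite: GlazmanManolescu2019, §2.1, the sentence before Lemma 2.2 («Summing the real part of (7) over all rhombi in a particular domain yields a relation on the partition function»)]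
[cite: DuminilCopinSmirnov2012, proof of Lemma 2 («Values at interior mid-edges disappear»)] -/
theorem sum_vertexFunctional_eq_boundarySum (W : CWeights) (t : ℂ) {c : Fin 4 → ℂ} (hcW : c 2 = -c 0)
    (hcS : c 3 = -c 1) (Dl : List Face) (a : MidEdge) :
    ∑ f ∈ Dl.toFinset, vertexFunctional W t c Dl a f = boundarySum W t c Dl a := by
  set S := Dl.toFinset with hS
  set F : MidEdge → ℂ := fun z => gmObservable W t Dl a z with hF
  have hmem : ∀ f : Face, f ∈ Dl ↔ f ∈ S := fun f => by rw [hS, List.mem_toFinset]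
  -- left side: horizontal and vertical telescoping parts
  have hL : ∑ f ∈ S, vertexFunctional W t c Dl a f =
      c 0 * ∑ f ∈ S, (F ((f + (1, 0)).side .W) - F (f.side .W)) +
        c 1 * ∑ f ∈ S, (F ((f + (0, 1)).side .S) - F (f.side .S)) := by
    rw [Finset.mul_sum, Finset.mul_sum, ← Finset.sum_add_distrib]
    refine Finset.sum_congr rfl fun f _ => ?_
    rw [vertexFunctional_eq_four, hcW, hcS, side_E_eq_side_W_add, side_N_eq_side_S_add]
    ring
  rw [hL, sum_sub_translate_eq S (1, 0) (fun f => F (f.side .W)),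
    sum_sub_translate_eq S (0, 1) (fun f => F (f.side .S))]
  -- right side: split the boundary sum by sides and identify each part
  have hR : boundarySum W t c Dl a =
      ∑ f ∈ S, ((if nbr f .E ∈ Dl then 0 else c 0 * F (f.side .E)) + (if nbr f .W ∈ Dl then 0 else c 2 * F (f.side .W)) +
        ((if nbr f .N ∈ Dl then 0 else c 1 * F (f.side .N)) + (if nbr f .S ∈ Dl then 0 else c 3 * F (f.side .S)))) := by
    unfold boundarySum
    refine Finset.sum_congr rfl fun f _ => ?_
    have hu : (Finset.univ : Finset Side) = {Side.W, Side.E, Side.S, Side.N} := by decide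
    rw [hu, Finset.sum_insert (by decide), Finset.sum_insert (by decide), Finset.sum_insert (by decide),
      Finset.sum_singleton]
    simp only [slotOfSide, hF]
    ring
  have hE : ∑ f ∈ S, (if nbr f .E ∈ Dl then 0 else c 0 * F (f.side .E)) =
      c 0 * ∑ f ∈ S.filter (fun f => f + (1, 0) ∉ S), F ((f + (1, 0)).side .W) := by
    rw [Finset.mul_sum, Finset.sum_filter]
    refine Finset.sum_congr rfl fun f _ => ?_
    rw [(nbr_eq f).1, side_E_eq_side_W_add]
    by_cases h : f + (1, 0) ∈ S
    · simp [h, (hmem _).2 h]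
    · simp [h, mt (hmem _).1 h]
  have hW : ∑ f ∈ S, (if nbr f .W ∈ Dl then 0 else c 2 * F (f.side .W)) =
      -(c 0 * ∑ f ∈ S.filter (fun f => f - (1, 0) ∉ S), F (f.side .W)) := by
    rw [Finset.mul_sum, ← Finset.sum_neg_distrib, Finset.sum_filter]
    refine Finset.sum_congr rfl fun f _ => ?_
    rw [(nbr_eq f).2.1, hcW]
    by_cases h : f - (1, 0) ∈ S
    · simp [h, (hmem _).2 h]
    · simp [h, mt (hmem _).1 h]
  have hN : ∑ f ∈ S, (if nbr f .N ∈ Dl then 0 else c 1 * F (f.side .N)) =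
      c 1 * ∑ f ∈ S.filter (fun f => f + (0, 1) ∉ S), F ((f + (0, 1)).side .S) := by
    rw [Finset.mul_sum, Finset.sum_filter]
    refine Finset.sum_congr rfl fun f _ => ?_
    rw [(nbr_eq f).2.2.1, side_N_eq_side_S_add]
    by_cases h : f + (0, 1) ∈ S
    · simp [h, (hmem _).2 h]
    · simp [h, mt (hmem _).1 h]
  have hS' : ∑ f ∈ S, (if nbr f .S ∈ Dl then 0 else c 3 * F (f.side .S)) =
      -(c 1 * ∑ f ∈ S.filter (fun f => f - (0, 1) ∉ S), F (f.side .S)) := by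
    rw [Finset.mul_sum, ← Finset.sum_neg_distrib, Finset.sum_filter]
    refine Finset.sum_congr rfl fun f _ => ?_
    rw [(nbr_eq f).2.2.2, hcS]
    by_cases h : f - (0, 1) ∈ S
    · simp [h, (hmem _).2 h]
    · simp [h, mt (hmem _).1 h]
  rw [hR, Finset.sum_add_distrib, Finset.sum_add_distrib, Finset.sum_add_distrib, hE, hW, hN, hS']
  ring

/-! ## §3. Consequences: the contour identity for outer roots, the total-defect identity for hole roots -/

/-- The Yang–Baxter coefficient vector has the contour shape `c_W = −c_E`, `c_S = −c_N`. [cite: GlazmanManolescu2019, Lemma 2.1, eq. (2.2) (CR)] -/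
theorem ybCoeff_shape (θ : ℝ) : ybCoeff θ 2 = -ybCoeff θ 0 ∧ ybCoeff θ 3 = -ybCoeff θ 1 := by
  simp [ybCoeff]

/-- ★★★ **THE CONTOUR IDENTITY ON AN ARBITRARY FINITE DOMAIN (outer root).** For the printed weights at any
`θ ∈ [π/3, 2π/3]`, on EVERY finite face list and for EVERY root on its OUTER boundary, the boundary sum of the
observable with the coefficients `(1, r(θ), −1, −r(θ))` VANISHES — Glazman–Manolescu's Lemma 2.2 («the discrete contour
integral vanishes») beyond rectangles, for arbitrary (possibly multiply connected) finite face lists, as long as the root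
is outer. [cite: GlazmanManolescu2019, Lemma 2.2] [cite: DuminilCopinSmirnov2012, Lemma 2] -/
theorem boundarySum_printed_eq_zero_of_outerRoot {θ : ℝ} (hθ : θ ∈ Set.Icc (π / 3) (2 * π / 3)) (Dl : List Face)
    (a : MidEdge) (hO : OuterRoot (dom Dl) a) :
    boundarySum (printedWeights θ) tFiveEighths (ybCoeff θ) Dl a = 0 := by
  rw [← sum_vertexFunctional_eq_boundarySum _ _ (ybCoeff_shape θ).1 (ybCoeff_shape θ).2]
  refine Finset.sum_eq_zero fun f hf => ?_
  exact vertexFunctional_printed_eq_zero hθ Dl a hO f (List.mem_toFinset.1 hf)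

/-- ★★★ **THE TOTAL-DEFECT IDENTITY (any root, e.g. a hole root).** The sum over ALL faces of the Yang–Baxter vertex
defects `VF_D(a, f)` of the printed weights equals the boundary sum of the observable (outer boundary AND hole
boundaries, the root term `c_a · F(a) = c_a` included): the defect table of a hole root, whatever it is, is globally
constrained by the boundary values. [cite: GlazmanManolescu2019, Lemma 2.2 (stated from [Gl, Lem. 4.1]; no proof printed)] -/
theorem sum_vertexFunctional_printed_eq_boundarySum (θ : ℝ) (Dl : List Face) (a : MidEdge) :
    ∑ f ∈ Dl.toFinset, vertexFunctional (printedWeights θ) tFiveEighths (ybCoeff θ) Dl a f =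
      boundarySum (printedWeights θ) tFiveEighths (ybCoeff θ) Dl a :=
  sum_vertexFunctional_eq_boundarySum _ _ (ybCoeff_shape θ).1 (ybCoeff_shape θ).2 Dl a

open Classical in
/-- ★★ **Defect localisation + Stokes**: if the vertex functional vanishes at every face of `Dl` outside a set `Z`
(e.g. by confinement, `PlaquetteWalkHoleRootConfinement`), the defects ON `Z` sum to the boundary sum.
[cite: GlazmanManolescu2019, Lemma 2.2 (stated from [Gl, Lem. 4.1]; no proof printed)] -/
theorem sum_vertexFunctional_filter_eq_boundarySum (θ : ℝ) (Dl : List Face) (a : MidEdge) (Z : Finset Face)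
    (hZ : ∀ f ∈ Dl, f ∉ Z → vertexFunctional (printedWeights θ) tFiveEighths (ybCoeff θ) Dl a f = 0) :
    ∑ f ∈ Dl.toFinset.filter (fun f => f ∈ Z), vertexFunctional (printedWeights θ) tFiveEighths (ybCoeff θ) Dl a f =
      boundarySum (printedWeights θ) tFiveEighths (ybCoeff θ) Dl a := by
  rw [← sum_vertexFunctional_printed_eq_boundarySum, ← Finset.sum_filter_add_sum_filter_not Dl.toFinset (fun f => f ∈ Z)]
  have h0 : ∑ f ∈ Dl.toFinset.filter (fun f => f ∉ Z), vertexFunctional (printedWeights θ) tFiveEighths (ybCoeff θ) Dl a f = 0 :=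
    Finset.sum_eq_zero fun f hf => by
      rw [Finset.mem_filter, List.mem_toFinset] at hf
      exact hZ f hf.1 hf.2
  rw [h0, add_zero]

/-! ## §4. The root term: `F(a) = 1` (the tree's `gmObservable_root` of `PlaquetteWalkIsthmusRoot`) -/

open Classical in
/-- ★★ **The contour identity with the root term isolated**: for an outer root `a` and the printed weights at
`θ ∈ [π/3, 2π/3]`, the boundary sum over the boundary sides OTHER than the root equals minus the root's own
coefficient: `Σ_{(f,s) boundary, f.side s ≠ a} c_s F(f.side s) = −Σ_{(f,s): f.side s = a, nbr f s ∉ Dl} c_s` (for a root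
on the `W` side of its unique face this is `+1`; GM19's «= 1» normalisation of Lemma 2.2).
[cite: GlazmanManolescu2019, Lemma 2.2] -/
theorem boundarySum_ne_root_eq_of_outerRoot {θ : ℝ} (hθ : θ ∈ Set.Icc (π / 3) (2 * π / 3)) (Dl : List Face)
    (a : MidEdge) (hO : OuterRoot (dom Dl) a) :
    ∑ f ∈ Dl.toFinset, ∑ s : Side,
        (if nbr f s ∈ Dl ∨ f.side s = a then 0
          else ybCoeff θ (slotOfSide s) * gmObservable (printedWeights θ) tFiveEighths Dl a (f.side s)) =
      -∑ f ∈ Dl.toFinset, ∑ s : Side, (if nbr f s ∉ Dl ∧ f.side s = a then ybCoeff θ (slotOfSide s) else 0) := by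
  have h := boundarySum_printed_eq_zero_of_outerRoot hθ Dl a hO
  unfold boundarySum at h
  have key : ∀ f ∈ Dl.toFinset,
      ((∑ s : Side, (if nbr f s ∈ Dl ∨ f.side s = a then 0
          else ybCoeff θ (slotOfSide s) * gmObservable (printedWeights θ) tFiveEighths Dl a (f.side s))) +
        ∑ s : Side, (if nbr f s ∉ Dl ∧ f.side s = a then ybCoeff θ (slotOfSide s) else 0)) =
      ∑ s : Side, (if nbr f s ∈ Dl then 0
        else ybCoeff θ (slotOfSide s) * gmObservable (printedWeights θ) tFiveEighths Dl a (f.side s)) := by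
    intro f _
    rw [← Finset.sum_add_distrib]
    refine Finset.sum_congr rfl fun s _ => ?_
    by_cases h1 : nbr f s ∈ Dl
    · simp [h1]
    · by_cases h2 : f.side s = a
      · simp [h1, h2, gmObservable_root]
      · simp [h1, h2]
  rw [eq_neg_iff_add_eq_zero, ← Finset.sum_add_distrib, Finset.sum_congr rfl key]
  exact h

end Literature.Barriers.CriticalPhenomena.PlaquetteWalk

/-! ## §5 (edition 3). The FLUX FORM: discrete Stokes on an arbitrary finite set of faces -/

namespace Literature.Barriers.CriticalPhenomena.PlaquetteWalk

open Literature.Probability.RandomPlanarGeometry.SAW.YangBaxter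
open Literature.Probability.RandomPlanarGeometry.SAW.YangBaxter.MidEdge
open Real Complex

open Classical in
/-- **The flux of `c · F` out of a finite set `S` of faces**: over the faces `f ∈ S` and the sides `s` of `f` whose
neighbour across `s` is NOT in `S`, `c_s · F(f.side s)` — the discrete contour integral of the observable (of the full
face list `Dl`, root `a`) around `S`; `S` need not be contained in `Dl`, nor connected, nor simply connected.
[cite: GlazmanManolescu2019, §2.1, sentence before Lemma 2.2 («the contour integral of F around any rhombus being null»)] -/
noncomputable def fluxSum (W : CWeights) (t : ℂ) (c : Fin 4 → ℂ) (Dl : List Face) (a : MidEdge) (S : Finset Face) : ℂ :=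
  ∑ f ∈ S, ∑ s : Side, if nbr f s ∈ S then 0 else c (slotOfSide s) * gmObservable W t Dl a (f.side s)

open Classical in
/-- ★★★ **DISCRETE STOKES ON AN ARBITRARY REGION.** For every weight system, phase, coefficient vector of the contour shape
(`c_W = −c_E`, `c_S = −c_N`), face list, root and EVERY finite set `S` of faces: `Σ_{f ∈ S} VF(f) = fluxSum S` — the sum
of the vertex functionals over a region is the flux of `c · F` through its boundary (interior mid-edges of `S` cancel in
pairs). § 2 is the case `S = Dl`. [cite: GlazmanManolescu2019, §2.1, the sentence before Lemma 2.2 («Summing the real part of (7) over all rhombi in a particular domain yields a relation on the partition function»); §2.1 (contour integral around any rhombus)]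
[cite: DuminilCopinSmirnov2012, proof of Lemma 2 («Values at interior mid-edges disappear»)] -/
theorem sum_vertexFunctional_eq_fluxSum (W : CWeights) (t : ℂ) {c : Fin 4 → ℂ} (hcW : c 2 = -c 0)
    (hcS : c 3 = -c 1) (Dl : List Face) (a : MidEdge) (S : Finset Face) :
    ∑ f ∈ S, vertexFunctional W t c Dl a f = fluxSum W t c Dl a S := by
  set F : MidEdge → ℂ := fun z => gmObservable W t Dl a z with hF
  have hL : ∑ f ∈ S, vertexFunctional W t c Dl a f =
      c 0 * ∑ f ∈ S, (F ((f + (1, 0)).side .W) - F (f.side .W)) +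
        c 1 * ∑ f ∈ S, (F ((f + (0, 1)).side .S) - F (f.side .S)) := by
    rw [Finset.mul_sum, Finset.mul_sum, ← Finset.sum_add_distrib]
    refine Finset.sum_congr rfl fun f _ => ?_
    rw [vertexFunctional_eq_four, hcW, hcS, side_E_eq_side_W_add, side_N_eq_side_S_add]
    ring
  rw [hL, sum_sub_translate_eq S (1, 0) (fun f => F (f.side .W)),
    sum_sub_translate_eq S (0, 1) (fun f => F (f.side .S))]
  have hR : fluxSum W t c Dl a S =
      ∑ f ∈ S, ((if nbr f .E ∈ S then 0 else c 0 * F (f.side .E)) + (if nbr f .W ∈ S then 0 else c 2 * F (f.side .W)) +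
        ((if nbr f .N ∈ S then 0 else c 1 * F (f.side .N)) + (if nbr f .S ∈ S then 0 else c 3 * F (f.side .S)))) := by
    unfold fluxSum
    refine Finset.sum_congr rfl fun f _ => ?_
    have hu : (Finset.univ : Finset Side) = {Side.W, Side.E, Side.S, Side.N} := by decide
    rw [hu, Finset.sum_insert (by decide), Finset.sum_insert (by decide), Finset.sum_insert (by decide),
      Finset.sum_singleton]
    simp only [slotOfSide, hF]
    ring
  have hE : ∑ f ∈ S, (if nbr f .E ∈ S then 0 else c 0 * F (f.side .E)) =
      c 0 * ∑ f ∈ S.filter (fun f => f + (1, 0) ∉ S), F ((f + (1, 0)).side .W) := by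
    rw [Finset.mul_sum, Finset.sum_filter]
    refine Finset.sum_congr rfl fun f _ => ?_
    rw [(nbr_eq f).1, side_E_eq_side_W_add]
    by_cases h : f + (1, 0) ∈ S
    · simp [h]
    · simp [h]
  have hW : ∑ f ∈ S, (if nbr f .W ∈ S then 0 else c 2 * F (f.side .W)) =
      -(c 0 * ∑ f ∈ S.filter (fun f => f - (1, 0) ∉ S), F (f.side .W)) := by
    rw [Finset.mul_sum, ← Finset.sum_neg_distrib, Finset.sum_filter]
    refine Finset.sum_congr rfl fun f _ => ?_
    rw [(nbr_eq f).2.1, hcW]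
    by_cases h : f - (1, 0) ∈ S
    · simp [h]
    · simp [h]
  have hN : ∑ f ∈ S, (if nbr f .N ∈ S then 0 else c 1 * F (f.side .N)) =
      c 1 * ∑ f ∈ S.filter (fun f => f + (0, 1) ∉ S), F ((f + (0, 1)).side .S) := by
    rw [Finset.mul_sum, Finset.sum_filter]
    refine Finset.sum_congr rfl fun f _ => ?_
    rw [(nbr_eq f).2.2.1, side_N_eq_side_S_add]
    by_cases h : f + (0, 1) ∈ S
    · simp [h]
    · simp [h]
  have hS' : ∑ f ∈ S, (if nbr f .S ∈ S then 0 else c 3 * F (f.side .S)) =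
      -(c 1 * ∑ f ∈ S.filter (fun f => f - (0, 1) ∉ S), F (f.side .S)) := by
    rw [Finset.mul_sum, ← Finset.sum_neg_distrib, Finset.sum_filter]
    refine Finset.sum_congr rfl fun f _ => ?_
    rw [(nbr_eq f).2.2.2, hcS]
    by_cases h : f - (0, 1) ∈ S
    · simp [h]
    · simp [h]
  rw [hR, Finset.sum_add_distrib, Finset.sum_add_distrib, Finset.sum_add_distrib, hE, hW, hN, hS']
  ring

open Classical in
/-- The boundary sum of § 2 is the flux out of the whole list. [cite: GlazmanManolescu2019, Lemma 2.2 (stated from [Gl, Lem. 4.1]; no proof printed)] -/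
theorem boundarySum_eq_fluxSum (W : CWeights) (t : ℂ) (c : Fin 4 → ℂ) (Dl : List Face) (a : MidEdge) :
    boundarySum W t c Dl a = fluxSum W t c Dl a Dl.toFinset := by
  unfold boundarySum fluxSum
  simp only [List.mem_toFinset]

open Classical in
/-- ★★ **LOCAL TOTAL-DEFECT IDENTITY**: if the vertex functional vanishes on `S` off a set `Z`, the defects of `S ∩ Z` sum to
the flux out of `S`. [cite: GlazmanManolescu2019, Lemma 2.2 (stated from [Gl, Lem. 4.1]; no proof printed)] -/
theorem sum_filter_vertexFunctional_eq_fluxSum (W : CWeights) (t : ℂ) {c : Fin 4 → ℂ} (hcW : c 2 = -c 0)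
    (hcS : c 3 = -c 1) (Dl : List Face) (a : MidEdge) (S Z : Finset Face)
    (hZ : ∀ f ∈ S, f ∉ Z → vertexFunctional W t c Dl a f = 0) :
    ∑ f ∈ S.filter (fun f => f ∈ Z), vertexFunctional W t c Dl a f = fluxSum W t c Dl a S := by
  rw [← sum_vertexFunctional_eq_fluxSum W t hcW hcS Dl a S, ← Finset.sum_filter_add_sum_filter_not S (fun f => f ∈ Z)]
  have h0 : ∑ f ∈ S.filter (fun f => f ∉ Z), vertexFunctional W t c Dl a f = 0 :=
    Finset.sum_eq_zero fun f hf => by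
      rw [Finset.mem_filter] at hf
      exact hZ f hf.1 hf.2
  rw [h0, add_zero]

/-- ★★ **ZERO FLUX AROUND A DEFECT-FREE REGION**: if `VF = 0` on every face of `S`, the flux of `c · F` out of `S` vanishes —
for ANY weights of the contour shape. [cite: GlazmanManolescu2019, §2.1 (the contour integral of F around any rhombus is null)] -/
theorem fluxSum_eq_zero_of_forall_eq_zero (W : CWeights) (t : ℂ) {c : Fin 4 → ℂ} (hcW : c 2 = -c 0) (hcS : c 3 = -c 1)
    (Dl : List Face) (a : MidEdge) (S : Finset Face) (h : ∀ f ∈ S, vertexFunctional W t c Dl a f = 0) :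
    fluxSum W t c Dl a S = 0 := by
  rw [← sum_vertexFunctional_eq_fluxSum W t hcW hcS Dl a S]
  exact Finset.sum_eq_zero h

/-- ★★ **THE DEFECT IS THE FLUX THROUGH ANY CONTOUR AROUND IT**: if `VF` vanishes on `S` except possibly at one face
`f⋆ ∈ S`, then `VF(f⋆) = fluxSum S`. (For the lane's hole roots: the far-cell defect equals the flux of `c · F` out of every
finite region containing the far cell and no other defect cell — a family of exact identities, one per region.)
[cite: GlazmanManolescu2019, Lemma 2.2 (stated from [Gl, Lem. 4.1]; no proof printed)] -/
theorem vertexFunctional_eq_fluxSum_of_eq_zero_off (W : CWeights) (t : ℂ) {c : Fin 4 → ℂ} (hcW : c 2 = -c 0)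
    (hcS : c 3 = -c 1) (Dl : List Face) (a : MidEdge) (S : Finset Face) {g : Face} (hg : g ∈ S)
    (h : ∀ f ∈ S, f ≠ g → vertexFunctional W t c Dl a f = 0) :
    vertexFunctional W t c Dl a g = fluxSum W t c Dl a S := by
  rw [← sum_vertexFunctional_eq_fluxSum W t hcW hcS Dl a S, Finset.sum_eq_single_of_mem g hg fun f hf hne => h f hf hne]

/-- ★★★ **DISCRETE HOLOMORPHICITY ON EVERY REGION (outer root).** For the printed weights at any `θ ∈ [π/3, 2π/3]`, every
finite face list `Dl`, every root on its OUTER boundary and EVERY finite set `S` of faces of the list, the flux of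
`c · F` out of `S` vanishes: `fluxSum S = 0` — Glazman–Manolescu's «the contour integral of F around any [union of] rhombi
is null», at face-list generality (the tree's C-B2 is the one-rhombus case, § 3 the whole-list case).
[cite: GlazmanManolescu2019, §2.1, sentence before Lemma 2.2; Lemma 2.1, eq. (CR)] -/
theorem fluxSum_printed_eq_zero_of_outerRoot {θ : ℝ} (hθ : θ ∈ Set.Icc (π / 3) (2 * π / 3)) (Dl : List Face)
    (a : MidEdge) (hO : OuterRoot (dom Dl) a) (S : Finset Face) (hS : ∀ f ∈ S, f ∈ Dl) :
    fluxSum (printedWeights θ) tFiveEighths (ybCoeff θ) Dl a S = 0 :=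
  fluxSum_eq_zero_of_forall_eq_zero _ _ (ybCoeff_shape θ).1 (ybCoeff_shape θ).2 Dl a S fun f hf =>
    vertexFunctional_printed_eq_zero hθ Dl a hO f (hS f hf)

/-- ★★ **Printed weights, any root: the defects in a region sum to the flux out of it** — `Σ_{f ∈ S} VF_θ(f) = fluxSum S`
for every finite `S` (hole roots included; no hypothesis). [cite: GlazmanManolescu2019, Lemma 2.2 (stated from [Gl, Lem. 4.1]; no proof printed)] -/
theorem sum_vertexFunctional_printed_eq_fluxSum (θ : ℝ) (Dl : List Face) (a : MidEdge) (S : Finset Face) :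
    ∑ f ∈ S, vertexFunctional (printedWeights θ) tFiveEighths (ybCoeff θ) Dl a f =
      fluxSum (printedWeights θ) tFiveEighths (ybCoeff θ) Dl a S :=
  sum_vertexFunctional_eq_fluxSum _ _ (ybCoeff_shape θ).1 (ybCoeff_shape θ).2 Dl a S

end Literature.Barriers.CriticalPhenomena.PlaquetteWalk
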